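import Literature.MathematicalPhysics.QuantumFieldTheory.Balaban1983to89.B15TreeGaugeT0

/-!
# `Balaban1983to89.B15TwoScaleT0` — T. Bałaban, *Large field renormalization. I. The basic step of the 𝐑 operation*, Commun. Math. Phys. **122** (1989) 175–202 [Balaban1989LargeFieldI], p. 196: the tree gauge `T₀` ACROSS AN INTERFACE OF TWO SCALES — *"It is one of the bonds intersecting the boundary ∂P₁, but they are bonds of the larger scale (they are L-bonds for the unit scale in P₁)"* — with the interface convention (7) p. 278 of T. Bałaban, *The variational problem and background fields in renormalization group method for lattice gauge theories*, Commun. Math. Phys. **102** (1985) 277–309 [Balaban1985Variational] (= [15] of [IV]) (PART 1/2: the two-scale carrier, the hypotheses, and the averages (42) of [Balaban1985Averaging] of a tree-gauged fine field)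

statement-level skeleton of published theorems with citation tags; proofs where landed; nothing here is a claim about the Yang–Mills mass gap

PDFs held: `paper:balaban1989-cmp122-large-field-i` (journal page = PDF page + 174; pp. 195–196 = PDF pp. 21–22, re-read AS
IMAGES for this file, renders `run/shared/lean/pub/pub-balaban/b2b-balaban-ref1/pages/1989-cmp122-large-field-I/…-p021-x2.png`,
`…-p022-x2.png`); `paper:balaban1985-cmp102-variational-background` (journal page = PDF page + 276; p. 278 = PDF p. 2, render
`…/1985-cmp102-variational-background/…-p002-x2.png`, read AS IMAGE); [Balaban1985Averaging] (42) p. 23 through the tree's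
`B7Prop1Explicit.bavg`.

WHAT IS REPRODUCED (mega-formalization `lit-balaban`, HOME `run/shared/lean/pub/lit-balaban/`, Phase-2 seat p26, generation 9;
rows `B15.Claim@196` / `B15.Def@196` of the SKELETON, owner r12 — the component recorded there as NOT MODELLED by the accepted
model instances `B15Claim196TreeGauge` (one annulus), `B15Claim196T0`/`B15Claim196T0Var` (a chain of annuli ON ONE LATTICE):
*"bonds joining annuli of different scales"*).  [IV] p. 195: *"We have to fix a gauge in P₁∖P₂, more precisely in the
intersection with the corresponding lattice. We may assume, rescaling properly, that it is the unit lattice."*  P. 196: *"We use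
all gauge degrees of freedom connected with points of P₁∖P₂, except one, so we add an external bond to the graph. It is one of
the bonds intersecting the boundary ∂P₁, but they are bonds of the larger scale (they are L-bonds for the unit scale in P₁),
except when P₁ = Λ, so it is simpler to describe the corresponding bond for P₂. … For the remaining domains P₂ we choose the
bond [(a′₁ − 1/2, a′₂ + 1/2, …, a′_d + 1/2), (a′₁ + 1/2, a′₂ + 1/2, …, a′_d + 1/2)], and add it to the graph. … The regularity
conditions for V″, V₀, and the gauge fixing for V′ introduce restrictions on this field. We can prove that it satisfies
|V′ − 1| < O(1)M²NR_k⁴ε_k on 𝔅₀."* (no proof is printed).  In print consecutive domains of the chain `Λ ⊃ Z″_k ⊃ ⋯ ⊃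
(Ω″^{~2}_{h+1})ᶜ` carry lattices whose spacings differ by the factor `L`, and the set `𝔅₀` contains, besides the bonds of each
annulus on its own lattice, the COARSE bonds crossing from the coarser annulus `P₁∖P₂` into `P₂` (the external bond of `T₀` is
one of them).  What "regularity conditions" mean for a configuration living on bonds of two scales is PRINTED in [15] = `B11`,
p. 278, the explanation of (7): *"|(∂V)(p′) − 1| < ε₁ for p′ ∈ 𝔅_k (7) … For some j between 0 and k p′ ∈ Λ_j. If p′ ⊂ Λ_j,
i.e. all four vertices of p′ belong to Λ_j, then the meaning of the symbol (∂V)(p′) is simple, then all four bonds of the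
boundary ∂p′ belong to Λ_j and we have (∂V)(p′) = V(∂p′). If p′ intersects the boundary of Λ_j, then some bonds b do not belong
to Λ_j and we replace V_b by V̄_b in the above equality. For example if p′ = ⟨x,y⟩∪⟨y,z⟩∪⟨z,w⟩∪⟨w,x⟩ and ⟨y,z⟩ do not belong to
Λ_j, then it means that y, z ∈ Λ_{j−1} and we define (∂V)(p′) = V(x,y)V̄(y,z)V(z,w)V(w,x)."* (`V̄` = the average (42) of
[Balaban1985Averaging] of the finer configuration).

THE MODEL (this PART 1).  Coarse coordinates: `P₁ = [lo, hi] ⊃ P₂ = [lo′, hi′]` boxes of `ℤ^d` (`d = n + 3`, `B7Prop1Explicit.Site`),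
the coarse annulus `P₁∖P₂ = ann lo hi lo′ hi′` with the contours of [IV] p. 196 (`B15TreeGauge196.contour lo hi τ`, threshold
`τ`).  Fine coordinates: the coarse site `z` sits over the fine site `cf L z = L·z` — the LOWER-CORNER block convention of the
tree's average (42) `B7Prop1Explicit.bavg` (block `B(L·z) = L·z + [0,L)^d`; print's centred blocks differ by a fixed
translation, under which print's inner end `(a′₁ + 1/2, …, a′_d + 1/2)` of the external bond becomes the initial point
`L·lo′` of the fine tree) — so `P₂` carries the fine box `[L·lo′, L·hi′ + (L−1)𝟙]` (`fhi`), inside which the NEXT domain of the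
chain is a fine box `[lo₂, hi₂]` and the fine annulus has its own p. 196 contours (threshold `τ′`).  A two-scale configuration
is a pair of bond fields `(Vc, Vf)` (coarse bonds / fine bonds) with values in a subgroup `G ≤ U1 𝔸` of the unit-norm units
of a complete normed `ℂ`-algebra `𝔸` (`M_N(ℂ)` with the operator norm) closed under the average (42)
(`B7Prop2Explicit.AvgClosed`: `U(N)`, `B7Prop2Explicit.avgClosed_unitaryUnits`).  The bonds of `𝔅₀` at the coarse scale are
the coarse bonds with both ends in `P₁` and at least one end in `P₁∖P₂`; those with exactly one end in `P₂` are the CROSSING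
bonds of this file.  `splice` is the coarse bond field of (7): `Vc`, except that a coarse bond with both ends in `P₂` carries the
average `bavg L Vf (L·z) κ` of the fine field over the block pair under it; `IfacePlaqSmall` = (7) for the coarse plaquettes with
corners in `P₁`, not all in `P₂`, formed with `splice`; `TwoScaleHyp` gathers the geometry (`IGeom`: `P₂` strictly inside `P₁`,
`lo′₁ ≤ τ ≤ hi′₁ − 1` — print's "a ∈ (a′₁, b′₁)"; fine `Geom`; margins of the fine inner box: `2L` fine layers above the lower
faces, `L` below the upper faces — print's distances between successive boundaries are `≥ 2MR_j ≫ L`), the regularity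
((7) with `ε_c`; `ε_f`-small fine plaquettes with corners in the fine annulus, `B16Ineq382.PlaqSmallOn`) and the smallness
`t ≤ 1/4` (`t = 2(d+1)L·δ_f`, `δ_f = (5W′² + dW′)ε_f`).

WHAT THIS PART PROVES (kernel; axioms standard).  §1 `hol_congr_of_pathIn` (a parallel transport depends only on the bonds
met), `pathIn_plaqWord`.  §2 first-layer bookkeeping (`FL` = the sites of `P₂` with an extremal coordinate = the inner ends of
the crossing bonds), `IGeom.geom`/`geom_shrink` (the contours of p. 196 serve `(P₁, P₂)` AND `(P₁, P₂ shrunk by one)` — they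
depend on `P₁` and `τ` only), `extOuter_mem_ann` (the outer end `lo′ − e₁` of the external bond).  §3: in the FINE TREE GAUGE
`V₀ = Vf^g`, `g(x) = Vf(Γ^f_{y′,x})` (`gF`; every fine bond of the fine annulus is `δ_f`-close to `1` by this seat's
`B16Ineq382.norm_bond_sub_one_le`, `fine_bondSmall`): the block pair under a first-layer coarse bond lies in the fine annulus
(`mem_annF_of_twoBlock`); the loops `V₀(Γ_{c,x})V₀(c)⁻¹` of (42) are `t`-close to `1` (`norm_Wcx_gauged_sub_one_le`: two tree
pieces of length `≤ dL`, two straight pieces of length `L`), hence so are those of `Vf` (`norm_Wcx_sub_one_le`, conjugation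
(45)/(11) [B7] `Wcx_gaugeAct`), the averages over first-layer block pairs are `G`-valued (`bavg_mem`, `bavg_gauged_mem`),
covariant (`bavg_gauged_eq` = `B7Prop1Explicit.bavg_gaugeAct`), and **`norm_bavg_gauged_sub_one_le`**: `‖V̄₀,c − 1‖ ≤ η =
(8d+10)L·δ_f` (`‖X_c‖ ≤ 2t` by (26) [B7] `MatrixLog.norm_mlog_le_two_mul`, `‖e^{X_c} − 1‖ ≤ e^{2t} − 1 ≤ 4t`, `V₀(Γ_c)`
`Lδ_f`-close to `1`).  PART 2 (`B15TwoScaleT0Cross`) proves from this the estimate on the CROSSING bonds in the two-scale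
`T₀` gauge (coarse contours, external bond, fine contours).

HONEST SCOPE / DIVERGENCES.  (1) No proof of the p. 196 claim is printed; this is the seat's proof for a MODEL of the printed
situation, as in the one-scale instances.  (2) Block convention: lower corners (`B7Prop1Explicit`), not print's centres; any
`L ≥ 1` (print: the lattices `L^{-j}ℤ^d`).  (3) The bound of PART 2 is polynomial in the widths `W, W′`, in `L` and `d`, times
`ε_c + ε_f`-type quantities; the printed power `O(1)M²NR_k⁴` is NOT derived (print states no derivation); see PART 2.  (4) Only
ONE interface (two consecutive domains of the chain) is modelled; the general chain alternates this file's interface with the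
one-lattice layers of `B15TreeGaugeT0` — not assembled here.  (5) (7) is typed with `≤ ε_c` where print has `<`.  (6) The fine
inner box `[lo₂, hi₂]` is where the next, finer, domain sits; its own interface is the same theorem one level down.
Unit `lit-balaban-p26` (literature-prover-lit-balaban-p26-g9-0).
-/

noncomputable section

open scoped BigOperators
open NormedSpace (exp)

namespace Literature.MathematicalPhysics.QuantumFieldTheory.Balaban1983to89.B15TwoScaleT0

open B7Prop1Explicit B8Lemma1NonAbelian B16Ineq382 B15TreeGauge196

-- `Site` alone would resolve to the torus sites of `Setup.lean`: re-export the `ℤ^d` sites (as `B15TreeGauge196`).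
export B7Prop1Explicit (Site)

variable {n : ℕ}

/-! ## §1 Walks: holonomies depend only on the bonds met; the unit plaquette as a walk -/

section Walks

variable {d : ℕ} {G : Type*} [Group G]

/-- Two bond fields that agree on every bond with both ends in `S` have the same parallel transport (9) [B7] along
every walk staying in `S`. [cite: Balaban1985Averaging, (9) p.18] -/
theorem hol_congr_of_pathIn {V V' : Site d → Fin d → G} {S : Set (Site d)}
    (h : ∀ (x : Site d) (κ : Fin d), x ∈ S → x + e κ ∈ S → V x κ = V' x κ) :
    ∀ {p : Site d} {w : List (Letter d)}, PathIn S p w → hol V p w = hol V' p w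
  | _, [], _ => rfl
  | p, l :: w, hw => by
    obtain ⟨hp, hw'⟩ := pathIn_cons.mp hw
    have hq : p + l.vec ∈ S := hw'.start
    rw [hol_cons, hol_cons, hol_congr_of_pathIn h hw']
    obtain ⟨κ, b⟩ := l
    cases b
    · rw [stepHol_false, stepHol_false, h (p - e κ) κ ?_ (by rwa [sub_add_cancel])]
      rwa [Letter.vec_false, ← sub_eq_add_neg] at hq
    · rw [stepHol_true, stepHol_true, h p κ hp ?_]
      rwa [Letter.vec_true] at hq

/-- The unit plaquette `∂p`, `p = (z; κ, μ)`, as a closed walk from `z`: its vertices are its four corners.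
[cite: Balaban1985Averaging, (44) p.24] -/
theorem pathIn_plaqWord {S : Set (Site d)} {z : Site d} {κ μ : Fin d} (h1 : z ∈ S) (h2 : z + e κ ∈ S)
    (h3 : z + e μ ∈ S) (h4 : z + e κ + e μ ∈ S) : PathIn S z (plaqWord κ μ) := by
  rw [plaqWord, pathIn_cons, Letter.vec_true, pathIn_cons, Letter.vec_true, pathIn_cons, Letter.vec_false,
    pathIn_cons, Letter.vec_false, pathIn_nil]
  refine ⟨h1, h2, h4, ?_, ?_⟩
  · rwa [show z + e κ + e μ + -e κ = z + e μ by abel]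
  · rwa [show z + e κ + e μ + -e κ + -e μ = z by abel]

end Walks

/-! ## §2 The geometry: coarse annulus `P₁ ∖ P₂`, its first layer inside `P₂`, the fine box under `P₂` -/

section Geometry

/-- The fine-lattice site under the coarse site `z`: `L·z` (block convention of `B7Prop1Explicit.bavg`: the coarse site
`z` is the lower corner `L·z` of its block `L·z + [0, L)^d`; print's centred blocks differ by a translation).
[cite: Balaban1989LargeFieldI, p.195] -/
def cf (L : ℕ) (z : Site (n + 3)) : Site (n + 3) := fun ν => (L : ℤ) * z ν

/-- The upper corner of the fine box under the coarse box `[lo′, hi′]`: `L·hi′ + (L − 1)·𝟙`.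
[cite: Balaban1989LargeFieldI, p.195] -/
def fhi (L : ℕ) (hi' : Site (n + 3)) : Site (n + 3) := fun ν => (L : ℤ) * hi' ν + ((L : ℤ) - 1)

variable {L : ℕ} {lo hi lo' hi' : Site (n + 3)} {τ : ℤ}

/-- `cf_apply` — bookkeeping. [cite: Balaban1989LargeFieldI, p.195] -/
@[simp] theorem cf_apply (L : ℕ) (z : Site (n + 3)) (ν : Fin (n + 3)) : cf L z ν = (L : ℤ) * z ν := rfl

/-- `fhi_apply` — bookkeeping. [cite: Balaban1989LargeFieldI, p.195] -/
@[simp] theorem fhi_apply (L : ℕ) (hi' : Site (n + 3)) (ν : Fin (n + 3)) :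
    fhi L hi' ν = (L : ℤ) * hi' ν + ((L : ℤ) - 1) := rfl

/-- `cf (z + e κ) = cf z + L·e κ`: a coarse bond covers `L` fine bonds. [cite: Balaban1989LargeFieldI, p.196] -/
theorem cf_add_e (L : ℕ) (z : Site (n + 3)) (κ : Fin (n + 3)) : cf L (z + e κ) = cf L z + (L : ℤ) • e κ := by
  funext ν
  simp only [cf_apply, Pi.add_apply, zsmul_e_apply, e_apply]
  split_ifs <;> ring

/-- The FIRST LAYER of the coarse box `P₂ = [lo′, hi′]`: its sites not in the shrunk box `[lo′ + 𝟙, hi′ − 𝟙]`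
(the coarse ends, inside `P₂`, of the bonds *"intersecting the boundary ∂P₂"*). [cite: Balaban1989LargeFieldI, p.196] -/
def FL (lo' hi' : Site (n + 3)) : Set (Site (n + 3)) := ann lo' hi' (lo' + 1) (hi' - 1)

/-- `mem_FL_iff` — unfolding. [cite: Balaban1989LargeFieldI, p.196] -/
theorem mem_FL_iff {z : Site (n + 3)} : z ∈ FL lo' hi' ↔ z ∈ box lo' hi' ∧ z ∉ box (lo' + 1) (hi' - 1) := Iff.rfl

/-- A first-layer site has an extremal coordinate. [cite: Balaban1989LargeFieldI, p.196] -/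
theorem exists_extremal_of_mem_FL {z : Site (n + 3)} (hz : z ∈ FL lo' hi') :
    ∃ ν, z ν = lo' ν ∨ z ν = hi' ν := by
  obtain ⟨hz1, hz2⟩ := mem_FL_iff.mp hz
  rw [mem_box_iff] at hz1 hz2
  obtain ⟨ν, hν⟩ := not_forall.mp hz2
  refine ⟨ν, ?_⟩
  have h1 := hz1 ν
  simp only [Pi.add_apply, Pi.sub_apply, Pi.one_apply, not_and_or, not_le] at hν
  omega

/-- A site of `P₂` with an extremal coordinate is in the first layer. [cite: Balaban1989LargeFieldI, p.196] -/
theorem mem_FL_of_extremal {z : Site (n + 3)} (hz : z ∈ box lo' hi') {ν : Fin (n + 3)}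
    (hν : z ν = lo' ν ∨ z ν = hi' ν) : z ∈ FL lo' hi' := by
  refine ⟨hz, fun h => ?_⟩
  have := (mem_box_iff.mp h) ν
  simp only [Pi.add_apply, Pi.sub_apply, Pi.one_apply] at this
  omega

/-- The first layer lies in `P₂`. [cite: Balaban1989LargeFieldI, p.196] -/
theorem FL_subset_box : FL lo' hi' ⊆ box lo' hi' := fun _ hz => hz.1

/-- A neighbour, inside `P₂`, of a site outside `P₂` is in the first layer. [cite: Balaban1989LargeFieldI, p.196] -/
theorem mem_FL_of_neighbour {z : Site (n + 3)} {κ : Fin (n + 3)} (hz : z ∉ box lo' hi')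
    (hz' : z + e κ ∈ box lo' hi') : z + e κ ∈ FL lo' hi' := by
  refine ⟨hz', fun h => hz ?_⟩
  rw [mem_box_iff] at h hz' ⊢
  intro ν
  have h1 := h ν; have h2 := hz' ν
  simp only [Pi.add_apply, Pi.sub_apply, Pi.one_apply, e_apply] at h1 h2 ⊢
  split_ifs at h1 h2 with hh <;> omega

/-- Symmetrically for the other end. [cite: Balaban1989LargeFieldI, p.196] -/
theorem mem_FL_of_neighbour' {z : Site (n + 3)} {κ : Fin (n + 3)} (hz : z ∈ box lo' hi')
    (hz' : z + e κ ∉ box lo' hi') : z ∈ FL lo' hi' := by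
  refine ⟨hz, fun h => hz' ?_⟩
  rw [mem_box_iff] at h hz ⊢
  intro ν
  have h1 := h ν; have h2 := hz ν
  simp only [Pi.add_apply, Pi.sub_apply, Pi.one_apply, e_apply] at h1 h2 ⊢
  split_ifs with hh <;> omega

/-- **The geometry of one interface** (p. 195 *"P₁ = [a₁,b₁] × ⋯ × [a_d,b_d] ⊃ P₂ = [a′₁,b′₁] × ⋯ × [a′_d,b′_d]"*,
p. 196 *"a number a ∈ (a′₁, b′₁)"*) in coarse site coordinates: `P₂` strictly inside `P₁`, and the threshold `τ`
(`x₁ ≦ a ⇔ x i0 ≤ τ`) admissible for `P₂` AND for `P₂` shrunk by one (`lo′₁ ≤ τ ≤ hi′₁ − 1`: the detour of the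
contours of p. 196 also passes around the shrunk box). [cite: Balaban1989LargeFieldI, p.196] -/
structure IGeom (lo hi lo' hi' : Site (n + 3)) (τ : ℤ) : Prop where
  lo_lt : ∀ κ, lo κ < lo' κ
  inner : ∀ κ, lo' κ ≤ hi' κ
  lt_hi : ∀ κ, hi' κ < hi κ
  le_tau : lo' i0 ≤ τ
  tau_lt : τ + 1 ≤ hi' i0

/-- The pair `(P₁, P₂)` is a `Geom` of PART 3. [cite: Balaban1989LargeFieldI, p.196] -/
theorem IGeom.geom (h : IGeom lo hi lo' hi' τ) : Geom lo hi lo' hi' τ :=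
  ⟨h.lo_lt, h.lt_hi, by have := h.le_tau; omega, by have := h.tau_lt; omega⟩

/-- The pair `(P₁, P₂ shrunk by one)` is a `Geom` of PART 3 (same contours: they depend on `P₁` and `τ` only).
[cite: Balaban1989LargeFieldI, p.196] -/
theorem IGeom.geom_shrink (h : IGeom lo hi lo' hi' τ) : Geom lo hi (lo' + 1) (hi' - 1) τ where
  lo_lt κ := by have := h.lo_lt κ; simp only [Pi.add_apply, Pi.one_apply]; omega
  lt_hi κ := by have := h.lt_hi κ; simp only [Pi.sub_apply, Pi.one_apply]; omega
  le_tau := by have := h.le_tau; simp only [Pi.add_apply, Pi.one_apply]; omega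
  tau_le := by have := h.tau_lt; simp only [Pi.sub_apply, Pi.one_apply]; omega

/-- The coarse annulus `P₁ ∖ P₂` lies in the bigger annulus `P₁ ∖ (P₂ shrunk)`. [cite: Balaban1989LargeFieldI, p.196] -/
theorem ann_subset_ann_shrink : ann lo hi lo' hi' ⊆ ann lo hi (lo' + 1) (hi' - 1) := by
  rintro z ⟨hz1, hz2⟩
  refine ⟨hz1, fun h => hz2 ?_⟩
  rw [mem_box_iff] at h ⊢
  intro ν; have := h ν
  simp only [Pi.add_apply, Pi.sub_apply, Pi.one_apply] at this
  omega

/-- The first layer of `P₂` lies in the annulus `P₁ ∖ (P₂ shrunk)`. [cite: Balaban1989LargeFieldI, p.196] -/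
theorem FL_subset_ann_shrink (h : IGeom lo hi lo' hi' τ) : FL lo' hi' ⊆ ann lo hi (lo' + 1) (hi' - 1) := by
  rintro z ⟨hz1, hz2⟩
  refine ⟨?_, hz2⟩
  rw [mem_box_iff] at hz1 ⊢
  intro ν; have := hz1 ν; have := h.lo_lt ν; have := h.lt_hi ν
  omega

/-- The outer end `lo′ − e₁` of the external bond of `P₂` (p. 196 *"(a′₁ − 1/2, a′₂ + 1/2, …, a′_d + 1/2)"*) is a site of
`P₁ ∖ P₂`. [cite: Balaban1989LargeFieldI, p.196] -/
theorem extOuter_mem_ann (h : IGeom lo hi lo' hi' τ) : lo' - e i0 ∈ ann lo hi lo' hi' := by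
  refine ⟨mem_box_iff.mpr fun ν => ?_, not_mem_box_of_lt i0 ?_⟩
  · have := h.lo_lt ν; have := h.lt_hi ν; have := h.inner ν
    simp only [Pi.sub_apply, e_apply]
    split_ifs with hν
    · subst hν; omega
    · omega
  · simp [e_apply_self]

/-- The corner `lo′` of `P₂` (the inner end of the external bond) is a first-layer site. [cite: Balaban1989LargeFieldI, p.196] -/
theorem lo'_mem_FL (h : IGeom lo hi lo' hi' τ) : lo' ∈ FL lo' hi' :=
  mem_FL_of_extremal (mem_box_iff.mpr fun ν => ⟨le_rfl, h.inner ν⟩) (ν := i0) (Or.inl rfl)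

end Geometry


/-! ## §3 The two-scale configuration: the interface convention (7) of [15], the hypotheses, the fine tree gauge -/

section Config

variable {𝔸 : Type*} [NormedRing 𝔸] [NormOneClass 𝔸] [NormedAlgebra ℂ 𝔸] [CompleteSpace 𝔸]

open Classical in
/-- **[15] p. 278 (7), the regularity condition of a multi-scale configuration AT AN INTERFACE**, verbatim: *"|(∂V)(p′) − 1| <
ε₁ for p′ ∈ 𝔅_k (7) … This requires an explanation. For some j between 0 and k p′ ∈ Λ_j. If p′ ⊂ Λ_j, i.e. all four
vertices of p′ belong to Λ_j, then … (∂V)(p′) = V(∂p′). If p′ intersects the boundary of Λ_j, then some bonds b do not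
belong to Λ_j and we replace V_b by V̄_b in the above equality. For example if p′ = ⟨x,y⟩∪⟨y,z⟩∪⟨z,w⟩∪⟨w,x⟩ and ⟨y,z⟩ do
not belong to Λ_j, then it means that y, z ∈ Λ_{j−1} and we define (∂V)(p′) = V(x,y)V̄(y,z)V(z,w)V(w,x)."* — the
coarse-scale bond field entering `(∂V)(p′)` for the coarse plaquettes at the interface `∂P₂`: the coarse bond variables `Vc`
on the bonds with an end outside `P₂`, and, on a coarse bond with BOTH ends in `P₂` (= the finer region `Λ_{j−1}`), the
average (42) [Balaban1985Averaging] `V̄` of the fine configuration `Vf` over the block pair under it (`B7Prop1Explicit.bavg`).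
[cite: Balaban1985Variational, (7) p.278] -/
def splice (L : ℕ) (lo' hi' : Site (n + 3)) (Vc Vf : Site (n + 3) → Fin (n + 3) → 𝔸ˣ) :
    Site (n + 3) → Fin (n + 3) → 𝔸ˣ := fun z κ =>
  if z ∈ box lo' hi' ∧ z + e κ ∈ box lo' hi' then bavg L Vf (cf L z) κ else Vc z κ

/-- **(7) on the coarse plaquettes meeting the coarse annulus**: every coarse unit plaquette with its four corners in `P₁`
and NOT all four in `P₂` (it lies in `P₁ ∖ P₂` or *"intersects the boundary"* `∂P₂`) satisfies `‖(∂V)(p′) − 1‖ ≤ ε_c`,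
with `(∂V)(p′)` formed from the spliced field `splice`. [cite: Balaban1985Variational, (7) p.278] -/
def IfacePlaqSmall (L : ℕ) (lo hi lo' hi' : Site (n + 3)) (Vc Vf : Site (n + 3) → Fin (n + 3) → 𝔸ˣ) (εc : ℝ) :
    Prop :=
  ∀ (z : Site (n + 3)) (κ μ : Fin (n + 3)), κ ≠ μ →
    z ∈ box lo hi → z + e κ ∈ box lo hi → z + e μ ∈ box lo hi → z + e κ + e μ ∈ box lo hi →
    ¬ (z ∈ box lo' hi' ∧ z + e κ ∈ box lo' hi' ∧ z + e μ ∈ box lo' hi' ∧ z + e κ + e μ ∈ box lo' hi') →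
    ‖((hol (splice L lo' hi' Vc Vf) z (plaqWord κ μ) : 𝔸ˣ) : 𝔸) - 1‖ ≤ εc

/-- `δ_f := (5W′² + dW′)·ε_f` — PART 2's tree-gauge bond bound (`B16Ineq382.norm_bond_sub_one_le`) on the fine annulus.
[cite: Balaban1989LargeFieldI, p.196 (bound on V′)] -/
def δF (n W' : ℕ) (εf : ℝ) : ℝ := (5 * (W' : ℝ) ^ 2 + (n + 3) * W') * εf

/-- `t := 2(d + 1)L·δ_f` (`d = n + 3`) — bound on the loops `V(Γ_{c,x})V(c)⁻¹` of (42) [B7] in the fine tree gauge.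
[cite: Balaban1985Averaging, (42) p.23] -/
def tF (n L W' : ℕ) (εf : ℝ) : ℝ := 2 * ((n : ℝ) + 4) * L * δF n W' εf

/-- `η := (8d + 10)L·δ_f` (`d = n + 3`) — bound on `‖V̄₀,c − 1‖` for the average (42) of the tree-gauged fine field.
[cite: Balaban1985Averaging, (42) p.23] -/
def ηF (n L W' : ℕ) (εf : ℝ) : ℝ := (8 * (n : ℝ) + 34) * L * δF n W' εf

/-- **THE TWO-SCALE SITUATION of [IV] p. 196** *"It is one of the bonds intersecting the boundary ∂P₁, but they are bonds
of the larger scale (they are L-bonds for the unit scale in P₁)"*: a coarse annulus `P₁ ∖ P₂ = [lo, hi] ∖ [lo′, hi′]`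
(coarse site coordinates, threshold `τ`, at most `W + 1` sites per side) and, under `P₂`, the fine box
`[L·lo′, L·hi′ + (L−1)𝟙]` with its own inner box `[lo₂, hi₂]` (the next domain of the chain), threshold `τ′`, at most
`W′ + 1` sites per side — every coarse site `z` sitting over the fine site `L·z` (lower-corner blocks of `B7Prop1Explicit`);
`G`-valued coarse and fine bond fields `Vc`, `Vf` (`G ≤ U1 𝔸` closed under the average (42), `B7Prop2Explicit.AvgClosed`,
e.g. `U(N)`); the regularity (7) of [15]: `ε_c`-small coarse plaquettes meeting the coarse annulus, with the interface
convention (`IfacePlaqSmall`), and `ε_f`-small fine plaquettes with corners in the fine annulus; the fine inner box at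
least `2L` fine layers above the lower faces and `L` below the upper faces of the fine box (print: distances between
successive boundaries `≥ 2MR_j ≫ L`); and the smallness `t ≤ 1/4` of the fine regularity (the loops of (42) inside the
domain of `log`). [cite: Balaban1989LargeFieldI, p.196] -/
structure TwoScaleHyp (L : ℕ) (lo hi lo' hi' : Site (n + 3)) (τ : ℤ) (W : ℕ) (lo₂ hi₂ : Site (n + 3)) (τ' : ℤ)
    (W' : ℕ) (G : Subgroup 𝔸ˣ) (Vc Vf : Site (n + 3) → Fin (n + 3) → 𝔸ˣ) (εc εf : ℝ) : Prop where
  one_le : 1 ≤ L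
  igeom : IGeom lo hi lo' hi' τ
  width : ∀ κ, hi κ - lo κ ≤ W
  fgeom : Geom (cf L lo') (fhi L hi') lo₂ hi₂ τ'
  fwidth : ∀ κ, fhi L hi' κ - cf L lo' κ ≤ W'
  margin_lo : ∀ κ, (L : ℤ) * (lo' κ + 2) ≤ lo₂ κ
  margin_hi : ∀ κ, hi₂ κ + 1 ≤ (L : ℤ) * hi' κ
  avgClosed : B7Prop2Explicit.AvgClosed (n + 3) L G
  memc : ∀ x κ, Vc x κ ∈ G
  memf : ∀ x κ, Vf x κ ∈ G
  epsc_nonneg : 0 ≤ εc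
  epsf_nonneg : 0 ≤ εf
  plaqc : IfacePlaqSmall L lo hi lo' hi' Vc Vf εc
  plaqf : B16Ineq382.PlaqSmallOn (ann (cf L lo') (fhi L hi') lo₂ hi₂) Vf εf
  small : tF n L W' εf ≤ 1 / 4

variable {L : ℕ} {lo hi lo' hi' lo₂ hi₂ : Site (n + 3)} {τ τ' : ℤ} {W W' : ℕ} {G : Subgroup 𝔸ˣ}
  {Vc Vf : Site (n + 3) → Fin (n + 3) → 𝔸ˣ} {εc εf : ℝ}

/-- The FINE TREE GAUGE of p. 196 under `P₂`: `g(x) = Vf(Γ^f_{y′,x})`, `y′ = L·lo′` the corner of the fine box.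
[cite: Balaban1989LargeFieldI, p.196] -/
def gF (L : ℕ) (lo' hi' : Site (n + 3)) (τ' : ℤ) (Vf : Site (n + 3) → Fin (n + 3) → 𝔸ˣ) : Site (n + 3) → 𝔸ˣ :=
  treeGaugeFn Vf (cf L lo') (fhi L hi') τ'

/-- `Vc` is `U1`-valued. [cite: Balaban1989LargeFieldI, p.196] -/
theorem TwoScaleHyp.unitc (H : TwoScaleHyp L lo hi lo' hi' τ W lo₂ hi₂ τ' W' G Vc Vf εc εf) :
    ∀ x κ, Vc x κ ∈ U1 𝔸 := fun x κ => H.avgClosed.le_U1 (H.memc x κ)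

/-- `Vf` is `U1`-valued. [cite: Balaban1989LargeFieldI, p.196] -/
theorem TwoScaleHyp.unitf (H : TwoScaleHyp L lo hi lo' hi' τ W lo₂ hi₂ τ' W' G Vc Vf εc εf) :
    ∀ x κ, Vf x κ ∈ U1 𝔸 := fun x κ => H.avgClosed.le_U1 (H.memf x κ)

/-- The fine gauge function is `G`-valued. [cite: Balaban1989LargeFieldI, p.196] -/
theorem TwoScaleHyp.gF_mem (H : TwoScaleHyp L lo hi lo' hi' τ W lo₂ hi₂ τ' W' G Vc Vf εc εf) (x : Site (n + 3)) :
    gF L lo' hi' τ' Vf x ∈ G := B7Prop2Explicit.hol_mem_of H.memf _ _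

/-- The fine gauge function is `U1`-valued. [cite: Balaban1989LargeFieldI, p.196] -/
theorem TwoScaleHyp.gF_unit (H : TwoScaleHyp L lo hi lo' hi' τ W lo₂ hi₂ τ' W' G Vc Vf εc εf) (x : Site (n + 3)) :
    gF L lo' hi' τ' Vf x ∈ U1 𝔸 := H.avgClosed.le_U1 (H.gF_mem x)

/-- At the fine root the gauge function is `1` (`Γ^f_{y′,y′}` is empty). [cite: Balaban1989LargeFieldI, p.196] -/
theorem TwoScaleHyp.gF_root (H : TwoScaleHyp L lo hi lo' hi' τ W lo₂ hi₂ τ' W' G Vc Vf εc εf) :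
    gF L lo' hi' τ' Vf (cf L lo') = 1 := by
  rw [gF, treeGaugeFn, contour_self H.fgeom.lo_le_tau, hol_nil]

/-- The tree-gauged fine field `V₀ = Vf^g` is `G`-valued. [cite: Balaban1989LargeFieldI, p.196] -/
theorem TwoScaleHyp.gauged_mem (H : TwoScaleHyp L lo hi lo' hi' τ W lo₂ hi₂ τ' W' G Vc Vf εc εf) (x : Site (n + 3))
    (κ : Fin (n + 3)) : gaugeAct (gF L lo' hi' τ' Vf) Vf x κ ∈ G :=
  G.mul_mem (G.mul_mem (H.gF_mem x) (H.memf x κ)) (G.inv_mem (H.gF_mem _))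

/-- `V₀ = Vf^g` is `U1`-valued. [cite: Balaban1989LargeFieldI, p.196] -/
theorem TwoScaleHyp.gauged_unit (H : TwoScaleHyp L lo hi lo' hi' τ W lo₂ hi₂ τ' W' G Vc Vf εc εf) :
    ∀ x κ, gaugeAct (gF L lo' hi' τ' Vf) Vf x κ ∈ U1 𝔸 := fun x κ => H.avgClosed.le_U1 (H.gauged_mem x κ)

/-- PART 2's hypotheses hold for the tree-gauged fine field on the fine annulus. [cite: Balaban1989LargeFieldI, p.196] -/
theorem TwoScaleHyp.case1Hyp_fine (H : TwoScaleHyp L lo hi lo' hi' τ W lo₂ hi₂ τ' W' G Vc Vf εc εf) :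
    Case1Hyp (cf L lo') (fhi L hi') lo₂ hi₂ τ' W' (gaugeAct (gF L lo' hi' τ' Vf) Vf) εf :=
  case1Hyp_gaugeFixed H.fgeom H.fwidth H.unitf H.epsf_nonneg H.plaqf

/-- `0 ≤ δ_f`. [cite: Balaban1989LargeFieldI, p.196] -/
theorem TwoScaleHyp.δF_nonneg (H : TwoScaleHyp L lo hi lo' hi' τ W lo₂ hi₂ τ' W' G Vc Vf εc εf) : 0 ≤ δF n W' εf := by
  have := H.epsf_nonneg; unfold δF; positivity

/-- `0 ≤ t`. [cite: Balaban1989LargeFieldI, p.196] -/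
theorem TwoScaleHyp.tF_nonneg (H : TwoScaleHyp L lo hi lo' hi' τ W lo₂ hi₂ τ' W' G Vc Vf εc εf) : 0 ≤ tF n L W' εf := by
  have := H.δF_nonneg; unfold tF; positivity

/-- `0 ≤ η`. [cite: Balaban1989LargeFieldI, p.196] -/
theorem TwoScaleHyp.ηF_nonneg (H : TwoScaleHyp L lo hi lo' hi' τ W lo₂ hi₂ τ' W' G Vc Vf εc εf) : 0 ≤ ηF n L W' εf := by
  have := H.δF_nonneg; unfold ηF; positivity

/-- **The fine tree gauge** ([IV] p. 196 for the fine annulus, PART 2): every fine bond with both ends in the fine annulus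
satisfies `‖V₀(b) − 1‖ ≤ δ_f`, `V₀ = Vf^g`. [cite: Balaban1989LargeFieldI, p.196 (bound on V′)] -/
theorem TwoScaleHyp.fine_bondSmall (H : TwoScaleHyp L lo hi lo' hi' τ W lo₂ hi₂ τ' W' G Vc Vf εc εf) :
    BondSmallOn (ann (cf L lo') (fhi L hi') lo₂ hi₂) (gaugeAct (gF L lo' hi' τ' Vf) Vf) (δF n W' εf) :=
  fun _ _ hx hx' => norm_bond_sub_one_le H.case1Hyp_fine hx hx'

/-- **The blocks under a first-layer coarse bond are in the fine annulus**: for `u` in the first layer of `P₂` and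
`u + e_κ ∈ P₂`, every fine site `x` with `L·u ≤ x ≤ L·u + (L−1)𝟙 + L·e_κ` (the block pair `B(c₋) ∪ B(c₊)` of the coarse
bond `c = ⟨u, u + e_κ⟩`, (42) [B7]) lies in the fine box and outside the fine inner box (the margins).
[cite: Balaban1989LargeFieldI, p.196] -/
theorem TwoScaleHyp.mem_annF_of_twoBlock (H : TwoScaleHyp L lo hi lo' hi' τ W lo₂ hi₂ τ' W' G Vc Vf εc εf)
    {u : Site (n + 3)} {κ : Fin (n + 3)} (hu : u ∈ FL lo' hi') (hu' : u + e κ ∈ box lo' hi') {x : Site (n + 3)}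
    (h1 : cf L u ≤ x) (h2 : ∀ ν, x ν ≤ (L : ℤ) * u ν + ((L : ℤ) - 1) + (L : ℤ) * e κ ν) :
    x ∈ ann (cf L lo') (fhi L hi') lo₂ hi₂ := by
  have hL : (0 : ℤ) ≤ L := Int.natCast_nonneg L
  have hub := mem_box_iff.mp (FL_subset_box hu)
  have hub' := mem_box_iff.mp hu'
  refine ⟨mem_box_iff.mpr fun ν => ⟨?_, ?_⟩, ?_⟩
  · have := mul_le_mul_of_nonneg_left (hub ν).1 hL
    exact this.trans (h1 ν)
  · have e1 := hub' ν
    simp only [Pi.add_apply] at e1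
    have := mul_le_mul_of_nonneg_left e1.2 hL
    have h2ν := h2 ν
    simp only [fhi_apply]
    nlinarith
  · obtain ⟨ν, hν | hν⟩ := exists_extremal_of_mem_FL hu
    · refine not_mem_box_of_lt ν ?_
      have h2ν := h2 ν
      have hm := H.margin_lo ν
      have he : (e κ : Site (n + 3)) ν ≤ 1 := by simp only [e_apply]; split_ifs <;> omega
      have := mul_le_mul_of_nonneg_left he hL
      nlinarith
    · refine not_mem_box_of_gt ν ?_
      have h1ν := h1 ν
      have hm := H.margin_hi ν
      simp only [cf_apply] at h1ν
      rw [hν] at h1ν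
      omega

/-- All coordinates are walked: `restrict` over the full list of directions is the identity. [cite: Balaban1989LargeFieldI, p.196] -/
theorem restrict_finRange_reverse {d : ℕ} (v : Site d) : restrict (List.finRange d).reverse v = v := by
  funext κ; simp [restrict]

/-- A site of the tree word `Γ_{q, q+r}`, `0 ≤ r ≤ (L−1)𝟙`, from `q = L·u` or from `q = L·u + L·e_κ`, and of the straight
segment `[q + r, q + r + L·e_κ]`, lies in the block pair under `⟨u, u + e_κ⟩`. [cite: Balaban1985Averaging, (42) p.23] -/
theorem coord_le_of_twoBlock {L : ℕ} {u z : Site (n + 3)} {κ : Fin (n + 3)} {rr : Fin (n + 3) → Fin L} {j : ℤ}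
    (hj : j ≤ L) (hz : z ≤ cf L u + j • e κ + boxVec L rr) (ν : Fin (n + 3)) :
    z ν ≤ (L : ℤ) * u ν + ((L : ℤ) - 1) + (L : ℤ) * e κ ν := by
  have h := hz ν
  have hr := (rr ν).isLt
  simp only [Pi.add_apply, cf_apply, zsmul_e_apply, boxVec, e_apply] at h ⊢
  split_ifs at h ⊢ <;> omega

/-- **The loops of the average (42) in the fine tree gauge**: for a first-layer coarse bond `c = ⟨u, u + e_κ⟩` and every
`x = L·u + r` of the block `B(c₋)`, `‖V₀(Γ_{c,x})V₀(c)⁻¹ − 1‖ ≤ t` — the two tree pieces have length `≤ dL`, the two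
straight pieces length `L`, every bond is `δ_f`-close to `1`. [cite: Balaban1985Averaging, (42) p.23] -/
theorem TwoScaleHyp.norm_Wcx_gauged_sub_one_le (H : TwoScaleHyp L lo hi lo' hi' τ W lo₂ hi₂ τ' W' G Vc Vf εc εf)
    {u : Site (n + 3)} {κ : Fin (n + 3)} (hu : u ∈ FL lo' hi') (hu' : u + e κ ∈ box lo' hi')
    (rr : Fin (n + 3) → Fin L) :
    ‖((Wcx L (gaugeAct (gF L lo' hi' τ' Vf) Vf) (cf L u) κ (boxVec L rr) : 𝔸ˣ) : 𝔸) - 1‖ ≤ tF n L W' εf := by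
  set V₀ := gaugeAct (gF L lo' hi' τ' Vf) Vf with hV₀
  set q := cf L u with hq
  set r := boxVec L rr with hr
  set A := ann (cf L lo') (fhi L hi') lo₂ hi₂ with hA
  have hU : ∀ x κ, V₀ x κ ∈ U1 𝔸 := H.gauged_unit
  have hB : BondSmallOn A V₀ (δF n W' εf) := H.fine_bondSmall
  have hr0 : (0 : Site (n + 3)) ≤ r := boxVec_nonneg L rr
  have hδ := H.δF_nonneg
  have hL0 : (0 : ℤ) ≤ L := Int.natCast_nonneg L
  -- membership of the pieces' sites in the fine annulus
  have hmem : ∀ (j : ℤ), 0 ≤ j → j ≤ L → ∀ z, q + j • e κ ≤ z → z ≤ q + j • e κ + r → z ∈ A := by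
    intro j hj0 hj z hz1 hz2
    refine H.mem_annF_of_twoBlock hu hu' (le_trans ?_ hz1) (coord_le_of_twoBlock hj hz2)
    exact le_add_of_nonneg_right (zsmul_e_nonneg hj0 κ)
  -- the three walks
  have hT1 : PathIn A q (treeWord r) := by
    rw [treeWord_eq_tw]
    refine pathIn_tw _ (List.nodup_reverse.mpr (List.nodup_finRange _)) r (fun κ' _ => hr0 κ') q fun z hz1 hz2 => ?_
    rw [restrict_finRange_reverse] at hz2
    exact hmem 0 le_rfl hL0 z (by simpa using hz1) (by simpa using hz2)
  have hT2 : PathIn A (q + (L : ℤ) • e κ) (treeWord r) := by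
    rw [treeWord_eq_tw]
    refine pathIn_tw _ (List.nodup_reverse.mpr (List.nodup_finRange _)) r (fun κ' _ => hr0 κ') _ fun z hz1 hz2 => ?_
    rw [restrict_finRange_reverse] at hz2
    exact hmem L hL0 le_rfl z hz1 hz2
  have hS : PathIn A (q + r) (seg κ (L : ℤ)) := by
    rw [pathIn_seg_natCast]
    intro j hj
    refine hmem j (Int.natCast_nonneg j) (by exact_mod_cast hj) _ ?_ ?_
    · rw [add_right_comm]; exact le_add_of_nonneg_right hr0
    · rw [add_right_comm]
  -- the four factors
  have hlen : (treeWord r).length ≤ (n + 3) * L := by rw [length_treeWord]; exact l1_boxVec_le L rr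
  have e1 : ‖((hol V₀ q (treeWord r) : 𝔸ˣ) : 𝔸) - 1‖ ≤ (n + 3) * L * δF n W' εf := by
    refine (norm_hol_sub_one_le_of_pathIn hU hB q _ hT1).trans ?_
    have : ((treeWord r).length : ℝ) ≤ (n + 3) * L := by exact_mod_cast hlen
    nlinarith
  have e2 : ‖((hol V₀ (q + r) (seg κ (L : ℤ)) : 𝔸ˣ) : 𝔸) - 1‖ ≤ L * δF n W' εf := by
    refine (norm_hol_sub_one_le_of_pathIn hU hB _ _ hS).trans ?_
    rw [length_seg, Int.natAbs_natCast]
  have e3 : ‖((hol V₀ (q + (L : ℤ) • e κ) (treeWord r) : 𝔸ˣ) : 𝔸) - 1‖ ≤ (n + 3) * L * δF n W' εf := by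
    refine (norm_hol_sub_one_le_of_pathIn hU hB _ _ hT2).trans ?_
    have : ((treeWord r).length : ℝ) ≤ (n + 3) * L := by exact_mod_cast hlen
    nlinarith
  have e4 : ‖((hol V₀ q (seg κ (L : ℤ)) : 𝔸ˣ) : 𝔸) - 1‖ ≤ L * δF n W' εf := by
    have hS' : PathIn A q (seg κ (L : ℤ)) := by
      rw [pathIn_seg_natCast]
      intro j hj
      refine hmem j (Int.natCast_nonneg j) (by exact_mod_cast hj) _ le_rfl (le_add_of_nonneg_right hr0)
    refine (norm_hol_sub_one_le_of_pathIn hU hB _ _ hS').trans ?_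
    rw [length_seg, Int.natAbs_natCast]
  -- `V₀(Γ_{c,x})V₀(c)⁻¹ = V₀(Γ_{q,q+r}) · V₀([q+r, q+r+Le_κ]) · V₀(Γ_{q+Le_κ, q+Le_κ+r})⁻¹ · V₀([q, q+Le_κ])⁻¹`
  have hrev : hol V₀ (q + (r + (L : ℤ) • e κ)) (revWord (treeWord r)) = (hol V₀ (q + (L : ℤ) • e κ) (treeWord r))⁻¹ :=
    hol_revWord' V₀ _ _ (by rw [disp_treeWord]; abel)
  have hW : Wcx L V₀ q κ r = hol V₀ q (treeWord r) * hol V₀ (q + r) (seg κ (L : ℤ)) *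
      (hol V₀ (q + (L : ℤ) • e κ) (treeWord r))⁻¹ * (hol V₀ q (seg κ (L : ℤ)))⁻¹ := by
    rw [Wcx, gammaWord, hol_append, hol_append, disp_append, disp_treeWord, disp_seg, hrev]
  rw [hW]
  have m1 := hol_mem hU q (treeWord r)
  have m2 := hol_mem hU (q + r) (seg κ (L : ℤ))
  have m3 := (U1 𝔸).inv_mem (hol_mem hU (q + (L : ℤ) • e κ) (treeWord r))
  have i3 := norm_inv_sub_one_le (hol_mem hU (q + (L : ℤ) • e κ) (treeWord r))
  have i4 := norm_inv_sub_one_le (hol_mem hU q (seg κ (L : ℤ)))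
  calc _ ≤ ‖((hol V₀ q (treeWord r) * hol V₀ (q + r) (seg κ (L : ℤ)) *
          (hol V₀ (q + (L : ℤ) • e κ) (treeWord r))⁻¹ : 𝔸ˣ) : 𝔸) - 1‖ + ‖(((hol V₀ q (seg κ (L : ℤ)))⁻¹ : 𝔸ˣ) : 𝔸) - 1‖ :=
        norm_units_mul_sub_one_le ((U1 𝔸).mul_mem ((U1 𝔸).mul_mem m1 m2) m3)
    _ ≤ (‖((hol V₀ q (treeWord r) * hol V₀ (q + r) (seg κ (L : ℤ)) : 𝔸ˣ) : 𝔸) - 1‖ +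
          ‖(((hol V₀ (q + (L : ℤ) • e κ) (treeWord r))⁻¹ : 𝔸ˣ) : 𝔸) - 1‖) + _ :=
        add_le_add (norm_units_mul_sub_one_le ((U1 𝔸).mul_mem m1 m2)) le_rfl
    _ ≤ ((‖((hol V₀ q (treeWord r) : 𝔸ˣ) : 𝔸) - 1‖ + ‖((hol V₀ (q + r) (seg κ (L : ℤ)) : 𝔸ˣ) : 𝔸) - 1‖) + _) + _ :=
        add_le_add (add_le_add (norm_units_mul_sub_one_le m1) le_rfl) le_rfl
    _ ≤ (((n + 3) * L * δF n W' εf + L * δF n W' εf) + (n + 3) * L * δF n W' εf) + L * δF n W' εf :=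
        add_le_add (add_le_add (add_le_add e1 e2) (i3.trans e3)) (i4.trans e4)
    _ = tF n L W' εf := by unfold tF; ring

/-- The loops of (42) for the UNGAUGED fine field are conjugates of those in the tree gauge ((45)/(11) [B7],
`Wcx_gaugeAct`): the same bound `≤ t`. [cite: Balaban1985Averaging, (45) p.24] -/
theorem TwoScaleHyp.norm_Wcx_sub_one_le (H : TwoScaleHyp L lo hi lo' hi' τ W lo₂ hi₂ τ' W' G Vc Vf εc εf)
    {u : Site (n + 3)} {κ : Fin (n + 3)} (hu : u ∈ FL lo' hi') (hu' : u + e κ ∈ box lo' hi')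
    (rr : Fin (n + 3) → Fin L) :
    ‖((Wcx L Vf (cf L u) κ (boxVec L rr) : 𝔸ˣ) : 𝔸) - 1‖ ≤ tF n L W' εf := by
  have hg := Wcx_gaugeAct L (gF L lo' hi' τ' Vf) Vf (cf L u) κ (boxVec L rr)
  have heq : Wcx L Vf (cf L u) κ (boxVec L rr) =
      (gF L lo' hi' τ' Vf (cf L u))⁻¹ * Wcx L (gaugeAct (gF L lo' hi' τ' Vf) Vf) (cf L u) κ (boxVec L rr) *
        gF L lo' hi' τ' Vf (cf L u) := by
    rw [hg]; group
  rw [heq, Units.val_mul, Units.val_mul]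
  exact (norm_units_inv_conj_sub_one_le (H.gF_unit _) _).trans (H.norm_Wcx_gauged_sub_one_le hu hu' rr)

/-- `t ≤ 1/4 < 1`: the loops are inside the domain of `log` ((26) [B7]). [cite: Balaban1985Averaging, (26) p.21] -/
theorem TwoScaleHyp.norm_Wcx_sub_one_lt_one (H : TwoScaleHyp L lo hi lo' hi' τ W lo₂ hi₂ τ' W' G Vc Vf εc εf)
    {u : Site (n + 3)} {κ : Fin (n + 3)} (hu : u ∈ FL lo' hi') (hu' : u + e κ ∈ box lo' hi')
    (rr : Fin (n + 3) → Fin L) : ‖((Wcx L Vf (cf L u) κ (boxVec L rr) : 𝔸ˣ) : 𝔸) - 1‖ < 1 :=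
  ((H.norm_Wcx_sub_one_le hu hu' rr).trans H.small).trans_lt (by norm_num)

/-- **The average (42) of the fine field over a first-layer block pair is `G`-valued** (`AvgClosed`).
[cite: Balaban1985Averaging, (42) p.23] -/
theorem TwoScaleHyp.bavg_mem (H : TwoScaleHyp L lo hi lo' hi' τ W lo₂ hi₂ τ' W' G Vc Vf εc εf)
    {u : Site (n + 3)} {κ : Fin (n + 3)} (hu : u ∈ FL lo' hi') (hu' : u + e κ ∈ box lo' hi') :
    bavg L Vf (cf L u) κ ∈ G :=
  H.avgClosed.bavg_mem Vf H.memf _ _ fun rr => (H.norm_Wcx_sub_one_le hu hu' rr).trans H.small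

/-- The average of the tree-gauged fine field is `G`-valued too. [cite: Balaban1985Averaging, (42) p.23] -/
theorem TwoScaleHyp.bavg_gauged_mem (H : TwoScaleHyp L lo hi lo' hi' τ W lo₂ hi₂ τ' W' G Vc Vf εc εf)
    {u : Site (n + 3)} {κ : Fin (n + 3)} (hu : u ∈ FL lo' hi') (hu' : u + e κ ∈ box lo' hi') :
    bavg L (gaugeAct (gF L lo' hi' τ' Vf) Vf) (cf L u) κ ∈ G :=
  H.avgClosed.bavg_mem _ H.gauged_mem _ _ fun rr => (H.norm_Wcx_gauged_sub_one_le hu hu' rr).trans H.small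

/-- **(45)/(11) [B7] for the average**: `V̄[Vf^g]_c = g(c₋) V̄[Vf]_c g(c₊)⁻¹`, `c = ⟨L·u, L·(u + e_κ)⟩`.
[cite: Balaban1985Averaging, (45) p.24] -/
theorem TwoScaleHyp.bavg_gauged_eq (H : TwoScaleHyp L lo hi lo' hi' τ W lo₂ hi₂ τ' W' G Vc Vf εc εf)
    {u : Site (n + 3)} {κ : Fin (n + 3)} (hu : u ∈ FL lo' hi') (hu' : u + e κ ∈ box lo' hi') :
    bavg L (gaugeAct (gF L lo' hi' τ' Vf) Vf) (cf L u) κ =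
      gF L lo' hi' τ' Vf (cf L u) * bavg L Vf (cf L u) κ * (gF L lo' hi' τ' Vf (cf L (u + e κ)))⁻¹ := by
  rw [bavg_gaugeAct L H.gF_unit Vf (cf L u) κ (fun rr => H.norm_Wcx_sub_one_lt_one hu hu' rr), cf_add_e]

/-- **The average (42) of the tree-gauged fine field is close to `1`**: `‖V̄₀,c − 1‖ ≤ η = (8d+10)L·δ_f` for a first-layer
coarse bond `c` — the exponent `X_c` of (42) has `‖X_c‖ ≤ 2t` ((26) [B7]: `‖log W‖ ≤ 2‖W − 1‖`), `‖e^{X_c} − 1‖ ≤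
e^{2t} − 1 ≤ 4t`, and the straight piece `V₀(Γ_c)` is `Lδ_f`-close to `1`. [cite: Balaban1985Averaging, (42) p.23] -/
theorem TwoScaleHyp.norm_bavg_gauged_sub_one_le (H : TwoScaleHyp L lo hi lo' hi' τ W lo₂ hi₂ τ' W' G Vc Vf εc εf)
    {u : Site (n + 3)} {κ : Fin (n + 3)} (hu : u ∈ FL lo' hi') (hu' : u + e κ ∈ box lo' hi') :
    ‖((bavg L (gaugeAct (gF L lo' hi' τ' Vf) Vf) (cf L u) κ : 𝔸ˣ) : 𝔸) - 1‖ ≤ ηF n L W' εf := by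
  set V₀ := gaugeAct (gF L lo' hi' τ' Vf) Vf with hV₀
  set t := tF n L W' εf with htdef
  have ht0 : 0 ≤ t := H.tF_nonneg
  have ht4 : t ≤ 1 / 4 := H.small
  have hδ := H.δF_nonneg
  have hU : ∀ x κ, V₀ x κ ∈ U1 𝔸 := H.gauged_unit
  -- the exponent
  have hX : ‖Xavg L V₀ (cf L u) κ‖ ≤ 2 * t := by
    unfold Xavg
    refine norm_avg_le L H.one_le _ fun rr => ?_
    have hW := H.norm_Wcx_gauged_sub_one_le hu hu' rr
    exact (MatrixLog.norm_mlog_le_two_mul (hW.trans (ht4.trans (by norm_num)))).trans (by linarith)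
  have hexp1 : ‖exp (Xavg L V₀ (cf L u) κ) - 1‖ ≤ 4 * t := by
    refine (B7Transfer.norm_exp_sub_one_le_of_le _ hX).trans ?_
    have h := Real.abs_exp_sub_one_le (x := 2 * t) (by rw [abs_of_nonneg (by linarith)]; linarith)
    rw [abs_of_nonneg (by linarith : (0 : ℝ) ≤ 2 * t)] at h
    have := (le_abs_self _).trans h
    linarith
  have hexp2 : ‖exp (Xavg L V₀ (cf L u) κ)‖ ≤ 2 := by
    refine (norm_exp_le_of_norm_le _ hX).trans ?_
    have h := Real.abs_exp_sub_one_le (x := 2 * t) (by rw [abs_of_nonneg (by linarith)]; linarith)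
    rw [abs_of_nonneg (by linarith : (0 : ℝ) ≤ 2 * t)] at h
    have := (le_abs_self _).trans h
    linarith
  -- the straight piece
  have hS : PathIn (ann (cf L lo') (fhi L hi') lo₂ hi₂) (cf L u) (seg κ (L : ℤ)) := by
    rw [pathIn_seg_natCast]
    intro j hj
    refine H.mem_annF_of_twoBlock hu hu' (le_add_of_nonneg_right (zsmul_e_nonneg (Int.natCast_nonneg j) κ))
      fun ν => ?_
    have := (Fin.isLt (⟨0, H.one_le⟩ : Fin L))
    simp only [Pi.add_apply, cf_apply, zsmul_e_apply, e_apply]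
    split_ifs <;> omega
  have hseg : ‖((hol V₀ (cf L u) (seg κ (L : ℤ)) : 𝔸ˣ) : 𝔸) - 1‖ ≤ L * δF n W' εf := by
    refine (norm_hol_sub_one_le_of_pathIn hU H.fine_bondSmall _ _ hS).trans ?_
    rw [length_seg, Int.natAbs_natCast]
  -- `V̄₀,c = e^{X_c} V₀(Γ_c)`
  rw [bavg, Units.val_mul, val_expUnit]
  have hid : exp (Xavg L V₀ (cf L u) κ) * ((hol V₀ (cf L u) (seg κ (L : ℤ)) : 𝔸ˣ) : 𝔸) - 1 =
      exp (Xavg L V₀ (cf L u) κ) * (((hol V₀ (cf L u) (seg κ (L : ℤ)) : 𝔸ˣ) : 𝔸) - 1) + (exp (Xavg L V₀ (cf L u) κ) - 1) := by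
    rw [mul_sub, mul_one, sub_add_sub_cancel]
  rw [hid]
  calc _ ≤ ‖exp (Xavg L V₀ (cf L u) κ) * (((hol V₀ (cf L u) (seg κ (L : ℤ)) : 𝔸ˣ) : 𝔸) - 1)‖ + ‖exp (Xavg L V₀ (cf L u) κ) - 1‖ :=
        norm_add_le _ _
    _ ≤ ‖exp (Xavg L V₀ (cf L u) κ)‖ * ‖((hol V₀ (cf L u) (seg κ (L : ℤ)) : 𝔸ˣ) : 𝔸) - 1‖ + ‖exp (Xavg L V₀ (cf L u) κ) - 1‖ :=
        add_le_add (norm_mul_le _ _) le_rfl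
    _ ≤ 2 * (L * δF n W' εf) + 4 * t := add_le_add (mul_le_mul hexp2 hseg (norm_nonneg _) (by norm_num)) hexp1
    _ = ηF n L W' εf := by rw [htdef]; unfold ηF tF; ring

end Config

end Literature.MathematicalPhysics.QuantumFieldTheory.Balaban1983to89.B15TwoScaleT0
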